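import Summits.NavierStokesRegularity.NavierStokesRegularity.Theorems.AdaptedFrequencyAdaptedFrequencyConvergesStubEnstrophyC2Tools
import Summits.NavierStokesRegularity.NavierStokesRegularity.Theorems.AdaptedFrequencyAdaptedFrequencyConvergesStubEnstrophyC2Jet
import Summits.NavierStokesRegularity.NavierStokesRegularity.Theorems.AdaptedFrequencyAdaptedFrequencyConvergesStubFrequencyCeiling
import Literature.Analysis.FluidPDE.NormalisedPressureDischarge
import Literature.Analysis.FluidPDE.KNSSLiouvillePlanarHolds

/-! # Second-order kernel calculus: `H ∈ C²` near `T` — crux stmt-NavierStokesRegularity-10493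
(`AdaptedFrequency.AdaptedFrequencyConverges`), line unsteadiness-squeeze, stub `stub_enstrophyC2`

Final file (after the helpers `…StubEnstrophyC2Tools`, `…StubEnstrophyC2Jet`) for the registered
stub `stub_enstrophyC2` of line `unsteadiness-squeeze` (`--supports stmt-NavierStokesRegularity-10493`).
PROVED, exactly as registered: for a classical
solution `(u, p)` of Navier–Stokes on `ℝ³ × [0, T)` which is Leray–Hopf from a rapidly decaying
datum, and a flow-adapted, Gaussian-comparable backward kernel `G` on `[t₀, T)`, the adapted
enstrophy `H(t) = ∫ ‖curl u(t)‖² G(t)` is `C²` on `(t₁, T)` for some `t₁ ∈ [t₀, T)` — in fact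
with `t₁ = t₀` (the Type-I and singularity hypotheses are not used).

**Proof.** `C²` is a local property, so it suffices to treat windows `(a, b)`,
`t₀ < a < b < T` (`enstrophyC2_window`):
1. *First variation.* `H′ = F := ∫ q G` on `(t₀, T)` with the density
   `q = 2⟪ω, (∇u)ω⟫ − 2ν|∇ω|²_F`, `ω = curl u` (landed `frequencyCeiling_hasDerivAt`).
2. *The density as a smooth function of a bounded jet.* `q = Φ ∘ J`, `J = (ω, ∇u, ∇ω)`,
   `Φ(ω, A, B) = 2⟪ω, Aω⟫ − 2ν|B|²_F` smooth; on the window all spatial derivatives of `u` of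
   orders `≤ 4` are bounded (Tao 2013, Cor. 11.1 on the closed slab `[0, b]` and Sobolev
   imbedding, `enstrophyC2_slab_bounds`), so `J` and its first two spatial derivatives are
   bounded, and `q, ∇q, Δq` are bounded by the chain rule (`norm_iteratedFDeriv_comp_le`) with the
   derivatives of `Φ` bounded on the ball containing the jet (compactness).
3. *The time derivative of the jet.* `∂ₜω = (∇u)ω + νΔω − (∇ω)u` (vorticity equation, which
   eliminates the pressure) gives `∂ₜω` and, exchanging `∂ₜ` and `∇` on the open window
   (`enstrophyC2_hasDerivAt_fderiv_slice`), `∂ₜ∇ω = ∇(∂ₜω)`, both bounded by Leibniz bounds;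
   `∂ₜ∇u = ∇(∂ₜu) = ∇(νΔu − (u·∇)u − ∇p)` by the momentum equation, where the pressure gradient is
   that of the Riesz pressure, `∇p = ∇Q[u]` (Tao 2013, Lemma 4.1 (i), tree
   `pressure_sub_pressurePotential_eq`, finite energy from Leray–Hopf), and the Hessian `D²Q[u]`
   is bounded on the window (`enstrophyC2_norm_iteratedFDeriv_two_pressurePotential_le`: truncated
   Newtonian kernel against `D²` of the quadratic source, plus `D⁴Γ∞` against `|u|² ∈ L¹`). Hence
   `∂ₜq = DΦ(J) ∂ₜJ` is bounded.
4. *Second variation.* The transport-free first variation of the tree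
   (`hasDerivAt_integral_mul_kernel_of_bounds`, with the Gaussian majorant of `G` on the window)
   applies to `q`: `F′(t) = ∫ (∂ₜq + u·∇q − νΔq) G(t)`, and this is continuous in `t` by
   dominated convergence (`enstrophyC2_continuousOn_integral_mul`). So `F ∈ C¹` and `H ∈ C²` on
   the window (`contDiffOn_succ_iff_deriv_of_isOpen`).

Sources: C.-C. Poon, Comm. PDE 21 (1996) (first/second variation of parabolic frequencies);
T. Tao, Anal. PDE 6 (2013), Lemma 4.1 (i), Cor. 11.1; A. Majda, A. Bertozzi, *Vorticity and
Incompressible Flow* (2002), §1.4–§1.6 (vorticity equation, exchange of mixed partials).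
-/

noncomputable section

open scoped Topology InnerProductSpace RealInnerProductSpace Laplacian ContDiff
open Literature.Analysis.FluidPDE Set Filter MeasureTheory Function Metric

namespace Summit.NavierStokesRegularity.NavierStokesRegularity.Theorems.AdaptedFrequencyConverges.UnsteadinessSqueeze

open Literature.Analysis.FluidPDE.PineauVicol2026 (newtonNearMass)

-- nested operator types
set_option maxSynthPendingDepth 4

set_option maxHeartbeats 400000 in
/-- **`H ∈ C²` on compact windows.** For a classical solution `(u, p)` on `ℝ³ × [0, T)`,
Leray–Hopf from its rapidly decaying datum, and an adapted Gaussian-comparable backward kernel `G`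
on `[t₀, T)`, the adapted enstrophy `H = adaptedEnstrophy u G` is `C²` on every window
`(a, b)` with `t₀ < a < b < T`. Proof: `H′ = F := ∫ q G` with `q = 2⟪ω, (∇u)ω⟫ − 2ν|∇ω|²_F`
(`frequencyCeiling_hasDerivAt`); `q = Φ ∘ (ω, ∇u, ∇ω)` with `Φ` smooth and the jet bounded
together with its spatial derivatives (Tao 2013, Cor. 11.1 on the slab `[0, b]`) and its time
derivative (vorticity equation for `∂ₜω`, `∂ₜ∇ω`; momentum equation, pressure normalisation
`∇p = ∇Q[u]` (Tao 2013, Lemma 4.1) and the pressure-Hessian bound for `∂ₜ∇u`), so the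
transport-free first variation applies to `F` (`hasDerivAt_integral_mul_kernel_of_bounds`), and
`F′ = ∫ (∂ₜ + u·∇ − νΔ)q · G` is continuous (dominated convergence); hence `F ∈ C¹`, `H ∈ C²`. -/
theorem enstrophyC2_window {ν T t₀ : ℝ}
    {u : ℝ → EuclideanSpace ℝ (Fin 3) → EuclideanSpace ℝ (Fin 3)}
    {p : ℝ → EuclideanSpace ℝ (Fin 3) → ℝ} {x₀ : EuclideanSpace ℝ (Fin 3)}
    {G : ℝ → EuclideanSpace ℝ (Fin 3) → ℝ} (hν : 0 < ν)
    (hcl : IsClassicalNSSolutionOn (Ico 0 T) ν 0 u p) (hLH : IsLerayHopfOn T ν 0 (u 0) u)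
    (hdec : HasRapidSpatialDecay (u 0)) (ht₀ : t₀ ∈ Ico 0 T)
    (hG : IsAdaptedBackwardKernel ν u (Ico t₀ T) T x₀ G)
    (hcmp : IsGaussianComparable G (Ico t₀ T) T x₀) {a b : ℝ} (ht₀a : t₀ < a) (hab : a < b)
    (hbT : b < T) :
    ContDiffOn ℝ 2 (adaptedEnstrophy u G) (Ioo a b) := by
  -- ### windows and slabs
  have h0a : 0 < a := lt_of_le_of_lt ht₀.1 ht₀a
  have hb0 : 0 < b := h0a.trans hab
  have hS₀0 : Ioo a b ⊆ Ico 0 T := fun s hs => ⟨h0a.le.trans hs.1.le, hs.2.trans hbT⟩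
  have hS₀S : Ioo a b ⊆ Ico t₀ T := fun s hs => ⟨ht₀a.le.trans hs.1.le, hs.2.trans hbT⟩
  have hS₀T : Ioo a b ⊆ Ioo t₀ T := fun s hs => ⟨ht₀a.trans hs.1, hs.2.trans hbT⟩
  have hS₀b : Ioo a b ⊆ Ioo 0 b := fun s hs => ⟨h0a.trans hs.1, hs.2⟩
  have hIoo : Ioo a b ⊆ Icc 0 b := fun s hs => ⟨h0a.le.trans hs.1.le, hs.2.le⟩
  have hnhds : ∀ s ∈ Ioo a b, Ico 0 T ∈ 𝓝 s := fun s hs =>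
    mem_of_superset (isOpen_Ioo.mem_nhds hs) hS₀0
  have hU : UniqueDiffOn ℝ (Ioo a b) := uniqueDiffOn_Ioo a b
  have hm₀ : (a + b) / 2 ∈ Ioo a b := ⟨by linarith, by linarith⟩
  -- ### all spatial derivatives of `u` of orders `≤ 4` are bounded on the window (Tao 2013)
  obtain ⟨K, hKk⟩ := enstrophyC2_slab_bounds hν hcl hLH hdec h0a.le hb0 hbT
  -- one constant `L` for `u, ω = curl u, A = ∇u, B = ∇ω` and their derivatives
  have hK0 : 0 ≤ K := (norm_nonneg _).trans (hKk 0 (by norm_num) _ hm₀ 0)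
  have hκ0 : 0 ≤ ‖curlCLM‖ := norm_nonneg _
  obtain ⟨L, hLdef⟩ : ∃ L : ℝ, L = max K (‖curlCLM‖ * K) := ⟨_, rfl⟩
  have hKL : K ≤ L := by rw [hLdef]; exact le_max_left _ _
  have hL0 : 0 ≤ L := hK0.trans hKL
  have hus : ∀ s ∈ Ioo a b, ContDiff ℝ ∞ (u s) := fun s hs => hcl.contDiff_velocity (hS₀0 hs)
  have hωs : ∀ s ∈ Ioo a b, ContDiff ℝ ∞ (curl (u s)) := fun s hs => by
    rw [curl_eq_curlCLM_comp]
    exact curlCLM.contDiff.comp ((hus s hs).fderiv_right (m := ∞) le_rfl)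
  have hAs : ∀ s ∈ Ioo a b, ContDiff ℝ ∞ (fderiv ℝ (u s)) := fun s hs =>
    (hus s hs).fderiv_right (m := ∞) le_rfl
  have hBs : ∀ s ∈ Ioo a b, ContDiff ℝ ∞ (fderiv ℝ (curl (u s))) := fun s hs =>
    (hωs s hs).fderiv_right (m := ∞) le_rfl
  have huk : ∀ k ≤ 4, ∀ s ∈ Ioo a b, ∀ x, ‖iteratedFDeriv ℝ k (u s) x‖ ≤ L :=
    fun k hk s hs x => (hKk k hk s hs x).trans hKL
  have hωk : ∀ k ≤ 3, ∀ s ∈ Ioo a b, ∀ x, ‖iteratedFDeriv ℝ k (curl (u s)) x‖ ≤ L := by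
    intro k hk s hs x
    refine (enstrophyC2_norm_iteratedFDeriv_curl_le (hus s hs) k x).trans ?_
    rw [hLdef]
    exact (mul_le_mul_of_nonneg_left (hKk (k + 1) (by omega) s hs x) hκ0).trans (le_max_right _ _)
  have hAk : ∀ k ≤ 3, ∀ s ∈ Ioo a b, ∀ x, ‖iteratedFDeriv ℝ k (fderiv ℝ (u s)) x‖ ≤ L := by
    intro k hk s hs x
    rw [norm_iteratedFDeriv_fderiv]
    exact huk (k + 1) (by omega) s hs x
  have hBk : ∀ k ≤ 2, ∀ s ∈ Ioo a b, ∀ x, ‖iteratedFDeriv ℝ k (fderiv ℝ (curl (u s))) x‖ ≤ L := by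
    intro k hk s hs x
    rw [norm_iteratedFDeriv_fderiv]
    exact hωk (k + 1) (by omega) s hs x
  -- ### finite energy and the pressure: `∇p = ∇Q[u]`, `‖D²Q[u]‖ ≤ P`
  have hcl' : IsClassicalNSSolutionOn (Icc 0 b) ν 0 u p :=
    hcl.mono (Icc_subset_Ico_right hbT) (uniqueDiffOn_Icc hb0)
  obtain ⟨E₀, hE₀, hint, hEr⟩ := enstrophyC2_energy (b := b) hν hcl hLH hbT
  have hpQ : ∀ s ∈ Ioo a b, ∀ y, gradient (p s) y = gradient (pressurePotential (u s)) y := by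
    intro s hs y
    have hc := pressure_sub_pressurePotential_eq hν.le hcl' hE₀ hint hEr (hS₀b hs)
    have e : p s = fun z => pressurePotential (u s) z + (p s 0 - pressurePotential (u s) 0) := by
      funext z; have := hc z; linarith
    rw [e]
    unfold gradient
    rw [fderiv_add_const]
  obtain ⟨-, -, -, -, ⟨M₄, hM₄⟩⟩ := exists_bound_newtonFar_derivs (r₀ := (1 : ℝ)) (r₁ := 2)
    one_pos one_lt_two
  obtain ⟨P, hPdef⟩ : ∃ P : ℝ, P = newtonNearMass *
      (‖(traceCLM : (EuclideanSpace ℝ (Fin 3) →L[ℝ] EuclideanSpace ℝ (Fin 3)) →L[ℝ] ℝ)‖ *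
        ((1 + ‖(traceCLM : (EuclideanSpace ℝ (Fin 3) →L[ℝ] EuclideanSpace ℝ (Fin 3)) →L[ℝ] ℝ)‖) *
          (2 ^ 3 * L ^ 2))) + M₄ * E₀ := ⟨_, rfl⟩
  have hP : ∀ s ∈ Ioo a b, ∀ x, ‖iteratedFDeriv ℝ 2 (pressurePotential (u s)) x‖ ≤ P := by
    intro s hs x
    rw [hPdef]
    exact enstrophyC2_norm_iteratedFDeriv_two_pressurePotential_le (hus s hs) (hint s (hIoo hs))
      hL0 (fun j hj y => huk j hj s hs y) (hEr s (hIoo hs)) hM₄ x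
  -- ### the Gaussian majorant of the kernel on the window
  obtain ⟨M, hMi, hGM⟩ := enstrophyC2_gaussian_majorant hcmp hS₀S hab hbT
  -- ### the jet `J = (ω, ∇u, ∇ω)` and the density `q = Φ ∘ J`
  have hu : IsSmoothSpaceTimeOn (Ioo a b) u := hcl.smooth_velocity.mono hS₀0
  have hω : IsSmoothSpaceTimeOn (Ioo a b) fun s x => curl (u s) x := (hu.fderiv_slice hU).clm curlCLM
  have hA : IsSmoothSpaceTimeOn (Ioo a b) fun s x => fderiv ℝ (u s) x := hu.fderiv_slice hU
  have hB : IsSmoothSpaceTimeOn (Ioo a b) fun s x => fderiv ℝ (curl (u s)) x := hω.fderiv_slice hU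
  obtain ⟨Φ, hΦdef⟩ : ∃ Φ : EuclideanSpace ℝ (Fin 3) ×
      ((EuclideanSpace ℝ (Fin 3) →L[ℝ] EuclideanSpace ℝ (Fin 3)) ×
        (EuclideanSpace ℝ (Fin 3) →L[ℝ] EuclideanSpace ℝ (Fin 3))) → ℝ,
      Φ = fun v => 2 * ⟪v.1, v.2.1 v.1⟫ - 2 * ν * frobeniusNormSq v.2.2 := ⟨_, rfl⟩
  have hΦ : ContDiff ℝ ∞ Φ := by rw [hΦdef]; exact enstrophyC2_contDiff_density ν
  obtain ⟨J, hJdef⟩ : ∃ J : ℝ → EuclideanSpace ℝ (Fin 3) → EuclideanSpace ℝ (Fin 3) ×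
      ((EuclideanSpace ℝ (Fin 3) →L[ℝ] EuclideanSpace ℝ (Fin 3)) ×
        (EuclideanSpace ℝ (Fin 3) →L[ℝ] EuclideanSpace ℝ (Fin 3))),
      J = fun s x => (curl (u s) x, (fderiv ℝ (u s) x, fderiv ℝ (curl (u s)) x)) := ⟨_, rfl⟩
  have hJ : IsSmoothSpaceTimeOn (Ioo a b) J := by
    rw [hJdef]; exact hω.prodMk (hA.prodMk hB)
  have hJs : ∀ s ∈ Ioo a b, ContDiff ℝ ∞ (J s) := fun s hs => by
    rw [hJdef]; exact (hωs s hs).prodMk ((hAs s hs).prodMk (hBs s hs))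
  obtain ⟨q, hqdef⟩ : ∃ q : ℝ → EuclideanSpace ℝ (Fin 3) → ℝ, q = fun s x => Φ (J s x) :=
    ⟨_, rfl⟩
  have hq : IsSmoothSpaceTimeOn (Ioo a b) q := by rw [hqdef]; exact hΦ.comp_contDiffOn hJ
  have hqe : ∀ s x, q s x = 2 * ⟪curl (u s) x, fderiv ℝ (u s) x (curl (u s) x)⟫ -
      2 * ν * frobeniusNormSq (fderiv ℝ (curl (u s)) x) := by
    intro s x; simp only [hqdef, hΦdef, hJdef]
  have hqs : ∀ s ∈ Ioo a b, q s = Φ ∘ J s := fun s hs => by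
    funext x; simp only [hqdef, Function.comp_apply]
  -- sizes of the jet
  have hJ0 : ∀ s ∈ Ioo a b, ∀ x, ‖J s x‖ ≤ L := by
    intro s hs x
    have h1 := hωk 0 (by norm_num) s hs x
    have h2 := hAk 0 (by norm_num) s hs x
    have h3 := hBk 0 (by norm_num) s hs x
    rw [norm_iteratedFDeriv_zero] at h1 h2 h3
    simp only [hJdef, Prod.norm_mk]
    exact max_le h1 (max_le h2 h3)
  have hJi : ∀ i ≤ 2, ∀ s ∈ Ioo a b, ∀ x, ‖iteratedFDeriv ℝ i (J s) x‖ ≤ L := by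
    intro i hi s hs x
    rw [hJdef]
    exact enstrophyC2_norm_iteratedFDeriv_jet_le (hus s hs) (hωk i (by omega) s hs x)
      (hAk i (by omega) s hs x) (hBk i hi s hs x)
  -- ### bounds on `q`, `∇q`, `Δq` through `Φ`
  obtain ⟨C, hC0, hC⟩ := enstrophyC2_exists_bound_iteratedFDeriv hΦ L
  obtain ⟨D, hDdef⟩ : ∃ D : ℝ, D = max 1 L := ⟨_, rfl⟩
  have hqn : ∀ n ≤ 2, ∀ s ∈ Ioo a b, ∀ x, ‖iteratedFDeriv ℝ n (q s) x‖ ≤ 2 * C * D ^ 2 := by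
    intro n hn s hs x
    rw [hqs s hs, hDdef]
    exact enstrophyC2_norm_iteratedFDeriv_comp_le hΦ (hJs s hs) hC0 hC (hJ0 s hs x)
      (fun i hi => hJi i hi s hs x) hn
  obtain ⟨Mq, hMqdef⟩ : ∃ Mq : ℝ, Mq = 2 * C * D ^ 2 := ⟨_, rfl⟩
  have hMq0 : 0 ≤ Mq := by rw [hMqdef]; positivity
  have hq0 : ∀ s ∈ Ioo a b, ∀ x, |q s x| ≤ Mq := by
    intro s hs x
    rw [← Real.norm_eq_abs, ← norm_iteratedFDeriv_zero (𝕜 := ℝ) (f := q s), hMqdef]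
    exact hqn 0 (by norm_num) s hs x
  have hq1 : ∀ s ∈ Ioo a b, ∀ x, ‖fderiv ℝ (q s) x‖ ≤ Mq := by
    intro s hs x
    rw [← norm_iteratedFDeriv_one (𝕜 := ℝ), hMqdef]
    exact hqn 1 (by norm_num) s hs x
  have hq2 : ∀ s ∈ Ioo a b, ∀ x, |Δ (q s) x| ≤ 3 * Mq := by
    intro s hs x
    have h := norm_iteratedFDeriv_laplacian_le (hq.contDiff_slice hs) 0 x
    rw [norm_iteratedFDeriv_zero, finrank_euclideanSpace_fin, Nat.cast_ofNat, Real.norm_eq_abs] at h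
    refine h.trans ?_
    rw [hMqdef]
    exact mul_le_mul_of_nonneg_left (hqn 2 le_rfl s hs x) (by norm_num)
  -- ### the time derivative of the jet
  -- (i) `∂ₜω` from the vorticity equation
  have hcurl0 : ∀ s ∈ Ico 0 T, ∀ x : EuclideanSpace ℝ (Fin 3),
      curl ((0 : ℝ → EuclideanSpace ℝ (Fin 3) → EuclideanSpace ℝ (Fin 3)) s) x = 0 := fun s _ x =>
    curl_eq_zero_of_fderiv_eq_zero (by simp)
  have hclos : Ico 0 T ⊆ closure (interior (Ico (0 : ℝ) T)) := by
    have hT : (0 : ℝ) < T := hb0.trans hbT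
    rw [interior_Ico, closure_Ioo hT.ne]; exact Ico_subset_Icc_self
  obtain ⟨Rω, hRωdef⟩ : ∃ Rω : ℝ → EuclideanSpace ℝ (Fin 3) → EuclideanSpace ℝ (Fin 3),
      Rω = fun s => (fun y => fderiv ℝ (u s) y (curl (u s) y)) + ν • (fun y => Δ (curl (u s)) y) -
        (fun y => fderiv ℝ (curl (u s)) y (u s y)) := ⟨_, rfl⟩
  have hRω : ∀ s ∈ Ioo a b, ∀ y, deriv (fun r => curl (u r) y) s = Rω s y := by
    intro s hs y
    have hveq := hcl.vorticity_eq (uniqueDiffOn_Ico 0 T) hclos hcurl0 (hS₀0 hs) y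
    simp only [vorticity_apply, timeDerivWithin_apply, convect_apply] at hveq
    rw [derivWithin_of_mem_nhds (hnhds s hs)] at hveq
    rw [hRωdef]
    simp only [Pi.add_apply, Pi.sub_apply, Pi.smul_apply]
    rw [eq_sub_iff_add_eq]; exact hveq
  -- bounds on `Rω` and `∇Rω`
  obtain ⟨W, hWdef⟩ : ∃ W : ℝ, W = 2 * L ^ 2 + |ν| * (3 * L) + 2 * L ^ 2 := ⟨_, rfl⟩
  have hRωn : ∀ n ≤ 1, ∀ s ∈ Ioo a b, ∀ x, ‖iteratedFDeriv ℝ n (Rω s) x‖ ≤ W := by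
    intro n hn s hs x
    rw [hRωdef, hWdef]
    exact enstrophyC2_norm_iteratedFDeriv_vorticityRHS_le (hus s hs) hL0
      (fun k hk y => huk k hk s hs y) (fun k hk y => hωk k hk s hs y) hn x
  have hW0 : 0 ≤ W := (norm_nonneg _).trans (hRωn 0 (by norm_num) _ hm₀ 0)
  -- (ii) `∂ₜu` from the momentum equation, with the normalised pressure
  obtain ⟨Ru, hRudef⟩ : ∃ Ru : ℝ → EuclideanSpace ℝ (Fin 3) → EuclideanSpace ℝ (Fin 3),
      Ru = fun s => ν • (fun y => Δ (u s) y) - gradient (pressurePotential (u s)) -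
        (fun y => fderiv ℝ (u s) y (u s y)) := ⟨_, rfl⟩
  have hRu : ∀ s ∈ Ioo a b, ∀ y, deriv (fun r => u r y) s = Ru s y := by
    intro s hs y
    have hm := hcl.momentum s (hS₀0 hs) y
    simp only [timeDerivWithin_apply, convect_apply, Pi.zero_apply, add_zero] at hm
    rw [derivWithin_of_mem_nhds (hnhds s hs), hpQ s hs y] at hm
    rw [hRudef]
    simp only [Pi.sub_apply, Pi.smul_apply]
    exact eq_sub_of_add_eq hm
  have hRu1 : ∀ s ∈ Ioo a b, ∀ x, ‖iteratedFDeriv ℝ 1 (Ru s) x‖ ≤ |ν| * (3 * L) + P + 2 * L ^ 2 := by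
    intro s hs x
    have hQ2 : ContDiff ℝ 2 (pressurePotential (u s)) :=
      contDiff_pressurePotential ((hus s hs).of_le (by norm_cast)) (hint s (hIoo hs))
    rw [hRudef]
    exact enstrophyC2_norm_iteratedFDeriv_momentumRHS_le (hus s hs) hL0
      (fun k hk y => huk k hk s hs y) hQ2 (hP s hs) x
  -- (iii) the derivative of the jet along time lines, and of `q`
  obtain ⟨Z, hZdef⟩ : ∃ Z : ℝ, Z = W + (|ν| * (3 * L) + P + 2 * L ^ 2) := ⟨_, rfl⟩
  have hqt : ∀ s ∈ Ioo a b, ∀ x, |timeDerivWithin (Ioo a b) q s x| ≤ C * Z := by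
    intro s hs x
    -- the three time lines
    have hω' : HasDerivAt (fun r => curl (u r) x) (Rω s x) s := by
      have h := hω.hasDerivAt_timeLine isOpen_Ioo hs x
      beta_reduce at h
      rw [hRω s hs x] at h
      exact h
    have hA' : HasDerivAt (fun r => fderiv ℝ (u r) x) (fderiv ℝ (Ru s) x) s :=
      enstrophyC2_hasDerivAt_fderiv_slice isOpen_Ioo hu hs (hRu s hs) x
    have hB' : HasDerivAt (fun r => fderiv ℝ (curl (u r)) x) (fderiv ℝ (Rω s) x) s :=
      enstrophyC2_hasDerivAt_fderiv_slice isOpen_Ioo hω hs (hRω s hs) x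
    have hJ' : HasDerivAt (fun r => J r x) (Rω s x, (fderiv ℝ (Ru s) x, fderiv ℝ (Rω s) x)) s := by
      rw [hJdef]; exact hω'.prodMk (hA'.prodMk hB')
    have hJ'n : ‖(Rω s x, (fderiv ℝ (Ru s) x, fderiv ℝ (Rω s) x))‖ ≤ Z := by
      have e1 : ‖Rω s x‖ ≤ W := by
        rw [← norm_iteratedFDeriv_zero (𝕜 := ℝ) (f := Rω s)]; exact hRωn 0 (by norm_num) s hs x
      have e2 : ‖fderiv ℝ (Ru s) x‖ ≤ |ν| * (3 * L) + P + 2 * L ^ 2 := by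
        rw [← norm_iteratedFDeriv_one (𝕜 := ℝ)]; exact hRu1 s hs x
      have e3 : ‖fderiv ℝ (Rω s) x‖ ≤ W := by
        rw [← norm_iteratedFDeriv_one (𝕜 := ℝ)]; exact hRωn 1 le_rfl s hs x
      have hWA0 : 0 ≤ |ν| * (3 * L) + P + 2 * L ^ 2 := (norm_nonneg _).trans e2
      simp only [Prod.norm_mk, hZdef]
      exact max_le (by linarith) (max_le (by linarith) (by linarith))
    rw [timeDerivWithin_eq_deriv isOpen_Ioo hs q x]
    have e : (fun r => q r x) = fun r => Φ (J r x) := by rw [hqdef]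
    rw [e]
    exact enstrophyC2_abs_deriv_comp_le hΦ hJ' (hC 1 (by norm_num) _ (hJ0 s hs x)) hJ'n
  -- ### the first variation of `F = ∫ q G` on the window
  obtain ⟨Mt, hMtdef⟩ : ∃ Mt : ℝ, Mt = max (max Mq (3 * Mq)) (max (C * Z) L) := ⟨_, rfl⟩
  have hbd : ∀ s ∈ Ioo a b, ∀ x, |q s x| ≤ Mt ∧ ‖fderiv ℝ (q s) x‖ ≤ Mt ∧ |Δ (q s) x| ≤ Mt ∧
      |timeDerivWithin (Ioo a b) q s x| ≤ Mt ∧ ‖u s x‖ ≤ Mt := by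
    intro s hs x
    rw [hMtdef]
    refine ⟨(hq0 s hs x).trans ((le_max_left _ _).trans (le_max_left _ _)),
      (hq1 s hs x).trans ((le_max_left _ _).trans (le_max_left _ _)),
      (hq2 s hs x).trans ((le_max_right _ _).trans (le_max_left _ _)),
      (hqt s hs x).trans ((le_max_left _ _).trans (le_max_right _ _)), ?_⟩
    have h := huk 0 (by norm_num) s hs x
    rw [norm_iteratedFDeriv_zero] at h
    exact h.trans ((le_max_right _ _).trans (le_max_right _ _))
  have hGw : IsAdaptedBackwardKernel ν u (Ioo a b) T x₀ G := hG.mono hS₀S hU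
  have hG0 : ∀ s ∈ Ioo a b, ∀ x, 0 ≤ G s x := fun s hs x => (hGw.pos s hs x).le
  obtain ⟨Lq, hLqdef⟩ : ∃ Lq : ℝ → EuclideanSpace ℝ (Fin 3) → ℝ, Lq = fun s x =>
      timeDerivWithin (Ioo a b) q s x + fderiv ℝ (q s) x (u s x) - ν * (Δ (q s)) x := ⟨_, rfl⟩
  have hF' : ∀ s ∈ Ioo a b, HasDerivAt (fun r => ∫ x, q r x * G r x) (∫ x, Lq s x * G s x) s := by
    intro s hs
    rw [hLqdef]
    exact hasDerivAt_integral_mul_kernel_of_bounds isOpen_Ioo hGw.contDiffOn hGw.adjoint_eq hG0 hMi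
      hGM hu (fun s hs x => hcl.divFree s (hS₀0 hs) x) hq hbd hs
  -- ### continuity of `F′ = ∫ (Lq) G`
  have hMt0 : 0 ≤ Mt := hMq0.trans (by rw [hMtdef]; exact (le_max_left _ _).trans (le_max_left _ _))
  have hLq : IsSmoothSpaceTimeOn (Ioo a b) Lq := by
    have h1 : IsSmoothSpaceTimeOn (Ioo a b) (timeDerivWithin (Ioo a b) q) := hq.timeDerivWithin hU
    have h2 : IsSmoothSpaceTimeOn (Ioo a b) (fun s x => fderiv ℝ (q s) x (u s x)) :=
      (hq.fderiv_slice hU).clm_apply hu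
    have h3 : IsSmoothSpaceTimeOn (Ioo a b) (fun s x => (Δ (q s)) x) := hq.laplacian hU
    rw [hLqdef]
    exact (h1.add h2).sub (h3.const_smul ν)
  have hLq_bd : ∀ s ∈ Ioo a b, ∀ x, |Lq s x| ≤ Mt + Mt * Mt + |ν| * Mt := by
    intro s hs x
    obtain ⟨-, h2, h3, h4, h5⟩ := hbd s hs x
    have e2 : |fderiv ℝ (q s) x (u s x)| ≤ Mt * Mt := by
      rw [← Real.norm_eq_abs]
      exact ((fderiv ℝ (q s) x).le_opNorm _).trans (mul_le_mul h2 h5 (norm_nonneg _) hMt0)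
    rw [hLqdef]
    calc |timeDerivWithin (Ioo a b) q s x + fderiv ℝ (q s) x (u s x) - ν * (Δ (q s)) x|
        ≤ |timeDerivWithin (Ioo a b) q s x + fderiv ℝ (q s) x (u s x)| + |ν * (Δ (q s)) x| :=
          abs_sub _ _
      _ ≤ (|timeDerivWithin (Ioo a b) q s x| + |fderiv ℝ (q s) x (u s x)|) + |ν| * |(Δ (q s)) x| := by
          rw [abs_mul]; gcongr; exact abs_add_le _ _
      _ ≤ (Mt + Mt * Mt) + |ν| * Mt := by gcongr
  have hcont : ContinuousOn (fun s => ∫ x, Lq s x * G s x) (Ioo a b) :=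
    enstrophyC2_continuousOn_integral_mul hLq hGw.contDiffOn hG0 hMi hGM hLq_bd
  -- ### `H′ = F` on the window, and the assembly
  have hHF : ∀ s ∈ Ioo a b, HasDerivAt (adaptedEnstrophy u G) (∫ x, q s x * G s x) s := by
    intro s hs
    refine (frequencyCeiling_hasDerivAt hν hcl hLH hdec ht₀ hG hcmp (hS₀T hs)).congr_deriv
      (integral_congr_ae (Eventually.of_forall fun x => ?_))
    simp only [hqe]
  have hdiffH : DifferentiableOn ℝ (adaptedEnstrophy u G) (Ioo a b) := fun s hs =>
    (hHF s hs).differentiableAt.differentiableWithinAt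
  have hdiffF : DifferentiableOn ℝ (fun r => ∫ x, q r x * G r x) (Ioo a b) := fun s hs =>
    (hF' s hs).differentiableAt.differentiableWithinAt
  have hF1 : ContDiffOn ℝ 1 (fun r => ∫ x, q r x * G r x) (Ioo a b) := by
    rw [show (1 : ℕ∞ω) = 0 + 1 by norm_num, contDiffOn_succ_iff_deriv_of_isOpen isOpen_Ioo]
    refine ⟨hdiffF, fun h => absurd h (by simp), ?_⟩
    rw [contDiffOn_zero]
    exact hcont.congr fun s hs => (hF' s hs).deriv
  have h2 : ContDiffOn ℝ (1 + 1) (adaptedEnstrophy u G) (Ioo a b) := by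
    rw [contDiffOn_succ_iff_deriv_of_isOpen isOpen_Ioo]
    refine ⟨hdiffH, fun h => absurd h (by simp), ?_⟩
    exact hF1.congr fun s hs => (hHF s hs).deriv
  simpa [show ((1 : ℕ∞ω) + 1) = 2 by norm_num] using h2

/-- **Stub `stub_enstrophyC2`** of line `unsteadiness-squeeze` (crux `AdaptedFrequencyConverges`):
the adapted enstrophy `H(t) = ∫ ‖curl u(t)‖² G(t)` of a classical Leray–Hopf solution from a
rapidly decaying datum against an adapted, Gaussian-comparable backward kernel is `C²` on a left
neighbourhood of `T` — in fact on `(t₀, T)`: `C²` is local, and on every window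
`((t₀ + t)/2, (t + T)/2)` it is `enstrophyC2_window`. (The Type-I and singularity hypotheses are
not used.) -/
theorem stub_enstrophyC2 :
    ∀ (ν T : ℝ) (u : ℝ → EuclideanSpace ℝ (Fin 3) → EuclideanSpace ℝ (Fin 3)) (p : ℝ → EuclideanSpace ℝ (Fin 3) → ℝ) (x₀ : EuclideanSpace ℝ (Fin 3)) (t₀ : ℝ) (G : ℝ → EuclideanSpace ℝ (Fin 3) → ℝ), 0 < ν → 0 < T → IsClassicalNSSolutionOn (Ico 0 T) ν 0 u p → IsLerayHopfOn T ν 0 (u 0) u → HasRapidSpatialDecay (u 0) → IsTypeIBlowup u T → t₀ ∈ Ico 0 T → (∀ r : ℝ, 0 < r → eLpNorm (Function.uncurry u) ⊤ (volume.restrict (parabolicCylinder r (T, x₀))) = ⊤) → IsAdaptedBackwardKernel ν u (Ico t₀ T) T x₀ G → IsGaussianComparable G (Ico t₀ T) T x₀ → ∃ t₁ ∈ Ico t₀ T, ContDiffOn ℝ 2 (adaptedEnstrophy u G) (Ioo t₁ T) := by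
  intro ν T u p x₀ t₀ G hν _hT hcl hLH hdec _hTI ht₀ _hsing hG hcmp
  refine ⟨t₀, ⟨le_rfl, ht₀.2⟩, ?_⟩
  refine contDiffOn_of_locally_contDiffOn fun t ht => ?_
  refine ⟨Ioo ((t₀ + t) / 2) ((t + T) / 2), isOpen_Ioo, ⟨by linarith [ht.1], by linarith [ht.2]⟩,
    ?_⟩
  have hw := enstrophyC2_window hν hcl hLH hdec ht₀ hG hcmp (a := (t₀ + t) / 2)
    (b := (t + T) / 2) (by linarith [ht.1]) (by linarith [ht.1, ht.2]) (by linarith [ht.2])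
  exact hw.mono inter_subset_right

end Summit.NavierStokesRegularity.NavierStokesRegularity.Theorems.AdaptedFrequencyConverges.UnsteadinessSqueeze

end
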